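/-
Copyright (c) 2026 the pub-hodgecm-mathlib formalisation cell (harness21).  Prover seat hodgecm-mathlib-K2Liu-p11 (g5), Track B «K2-LIT»,
#184♮ = hLiu418 = `stmt-HodgeConjecture-24832`; socket #41 `sig_K2LiuSiegelEisensteinContinuation`, KIND W, brick (x-a-heb): THE FRAME READING OF THE
UNIPOTENT CHARACTER AT THE ARCHIMEDEAN PLACE — the letter `heb` of ★ `K2LiuKindWArchContinuationBridge.hex_of_sumPresentation` ∕ ★
`K2LiuKindWArchContinuationOfRecord` (KW desk F0P2-p08 (g3) 2026-09-05T00:23:32Z (2)(α) + 00:28:58Z (a): «K2Liu-p11's `heb` payer»); box K2Liu-audit1.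
THEOREMS ONLY (no `def`, no `instance`, no notation, no named-fact hypothesis, no `sorry`, default heartbeats).
-/
import Summits.HodgeConjecture.HodgeConjecture.Theorems.K2LiuArchUnipotentFrameCoordinates        -- ★ FILE 12 (K2Liu-p11 g4): `eq_conj_of_frame_conj_eq`, the by-value frame letters, `unipDeltaArch`
import Summits.HodgeConjecture.HodgeConjecture.Theorems.K2LiuSiegelUnipotentCharacterFactorisation -- ★ Φ3d (d1) (K2E5-p17): `unipDeltaChar_archToAdelic_archPart`, `map_trace_mul_toBlocks₁₂`
import Summits.HodgeConjecture.HodgeConjecture.Theorems.K2LiuSiegelUnipotentArchPlaces            -- ★ `mem_unipDeltaArch_iff_forall_archAt`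
import Summits.HodgeConjecture.HodgeConjecture.Theorems.K2LiuArchSiegelCharacterTube              -- ★ `isComplex_infinitePlace` (a CM field is totally complex)
import Literature.NumberTheory.Automorphic.UnitaryGroupArchToAdelicPlaces                         -- ★ `map_placeEval_coe_archToAdelic` (`σ_w((a,1)) = a_w`)
import Literature.NumberTheory.Automorphic.UnitaryGroupAdelicProduct                              -- ★ `archPart_archToAdelic`
import HarnessLib

/-!
# Crux `HLiu418`, socket #41, KIND W — brick (x-a-heb) `K2LiuKindWArchCharacterFrameReading`: THE CHARACTER'S FRAME READING
# `conj ψ_S(ι_∞ a) = ∏_{w complex} exp(−2πi · tr(h_w(S) · b_w(a)))`, `b_w(a) = (Fr a w)₁₂`, `h_w(S) = −2 · (T_w)₂₂ · σ_w(S) · (T_w⁻¹)₁₁`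

Cell `hodgecm-mathlib`, crux item hLiu418 = `stmt-HodgeConjecture-24832` (helper lane `--supports … --as helper`, count-neutral), route of record
`HCCMUnconditional`; squad K2 ∕ K2Liu, road `K2_Liu`, socket #41, KIND W; KW desk of record F0P2-p08 (g3).
THE LETTER PAID.  ★ (x-a-pres)(ii) `K2LiuKindWArchContinuationBridge.hex_of_sumPresentation` (R90-C10-p03) and ★ `K2LiuKindWArchContinuationOfRecord` (LH4-p10) take
BY VALUE the frame reading of the weight `Wt u := conj ψ_S(ι_∞ u)` of the twisted archimedean block:
  `heb : ∀ a : N_Δ(L⁺ ⊗ ℝ), conj (unipDeltaChar S (archToAdelic ↑a) : ℂ) = ∏ w, eb w (toBlocks₁₂ (Fr ↑a w))`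
for SOME place factors `eb w : M_n(ℂ) → ℂ`; the per-place Whittaker letters (★ `K2LiuKindWArchWhittakerLetter`, LH4-p08) read `eb w b = exp(−2πi·tr(h_w · b))` at a
framed index `h_w`.  THIS FILE computes `eb` and `h_w` from the definitions and proves `heb`:
* `ψ_S(u) = ψ_L(tr(S_𝔸 · X(u)))` (★ Φ1 `unipDeltaChar`), `X(u) = (blk u)₁₂`; at `u = ι_∞ a` the adele `tr(S_𝔸 X(u))` has finite part `0` and ★ Φ3d (d1)
  `unipDeltaChar_archToAdelic_archPart` isolates `ψ_S(ι_∞ a) = ψ_L((x_∞, 0))`; Tate's `ψ_L((x_∞,0)) = exp(−2πi · Tr_{L_∞∕ℝ}(x_∞))` (★ `adeleAddChar_apply_of_isFiniteIntegral`)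
  and `Tr_{L_∞∕ℝ} = Σ_w 2·Re σ_w(·)` on a totally complex `L` (§1);
* `σ_w(x_w) = tr(σ_w(S) · X(a_w))` with `a_w = archAt a w` (★ `map_placeEval_coe_archToAdelic`, ★ `map_trace_mul_toBlocks₁₂`) (§2);
* in the tube frame of record (`Fr a w = T_w · ã_w · T_w⁻¹`, by value): for `a ∈ N_Δ(L⁺⊗ℝ)`, `Fr a w = n(b_w)` with `b_w = (Fr a w)₁₂` hermitian (★ `hTiv`), so
  `X(a_w) = (T_w⁻¹ · n(b_w) · T_w)₁₂ = (T_w⁻¹)₁₁ · b_w · (T_w)₂₂` (pure block algebra, `T_w⁻¹ T_w = 1`) (§3);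
* hence `Tr = Σ_w 2 Re tr(σ_w(S)(T_w⁻¹)₁₁ b_w (T_w)₂₂) = −Σ_w Re tr(h_w · b_w)` with **`h_w := −2 · (T_w)₂₂ · σ_w(S) · (T_w⁻¹)₁₁`**, and
  `conj ψ_S(ι_∞ a) = exp(2πi · Tr) = ∏_w exp(−2πi · Re tr(h_w b_w))` (§4, `heb` with the REAL PART — unconditional);
* if the framed indices `h_w` are hermitian (true for `S` skew w.r.t. `gramR` in the Shimura frame — the signature bookkeeping of the per-place payers; here BY VALUE
  `hherm`), `tr(h_w b_w) ∈ ℝ` (`b_w` hermitian) and the real part drops: **`heb` EXACTLY in the shape the per-place letters read**, `eb w b = cexp(−(2πI)·tr(h_w · b))` (§5).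
NO parity, definiteness or closed form of the frame is used: only `T_w⁻¹ T_w = 1`, `hFr`, `hTiv` (★ FILE 12's by-value letters).
[CasselsFrohlichANT1967, Ch. XV (Tate) §2.2, Lemma 3.2.1, §4.1] [Shimura1997, §18.1 (18.4), §A3] [MoeglinWaldspurger1995, I.2.6, II.1.5] [BorelJacquet1979, §4.1].
HONEST LABEL.  Count-neutral helper; closes no socket by itself: `HC_CM` is proved only modulo the 7 printed citations (2 remaining named inputs:
hLiu418 = `stmt-HodgeConjecture-24832`, h413 = `stmt-HodgeConjecture-24833`) until rung 0 closes.  NOT HERE (by value): the hermitian-ness ∕ signature of the framed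
indices `h_w` in the closed-form Shimura frame (the per-place payers' `hidx` bookkeeping), and the per-place Whittaker letters themselves.

## References
* [CasselsFrohlichANT1967] J. Tate, *Fourier analysis in number fields and Hecke's zeta-functions*, in Cassels–Fröhlich, *Algebraic Number Theory* (1967), Ch. XV,
  §2.2 (local additive characters, `ψ_ℂ(z) = e^{−2πi·2Re z}`), Lemma 3.2.1, §4.1 (the global character `ψ_K`).
* [Shimura1997] G. Shimura, *Euler Products and Eisenstein Series*, CBMS 93 (1997), §18.1 (18.4) (`ψ(tr(β n(b)))`), §A3.
* [MoeglinWaldspurger1995] C. Mœglin, J.-L. Waldspurger, *Spectral Decomposition and Eisenstein Series* (1995), I.2.6, II.1.5.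
* [BorelJacquet1979] A. Borel, H. Jacquet, Proc. Symp. Pure Math. 33 (1979), §4.1 (archimedean components).
-/

set_option autoImplicit false
set_option linter.dupNamespace false -- the mandated namespace repeats `HodgeConjecture.HodgeConjecture`

noncomputable section

open scoped Matrix ComplexConjugate Classical
open Complex Matrix NumberField NumberField.InfinitePlace IsDedekindDomain
open Literature.NumberTheory.Automorphic Literature.NumberTheory.Automorphic.UnitaryGroup Literature.NumberTheory.GaloisRepresentations
open Literature.NumberTheory.GelbartRogawski1991 Literature.NumberTheory.GelbartRogawski1991.GRConstruction
open Literature.NumberTheory.K2Lit.SiegelDoubled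

namespace Summit.HodgeConjecture.HodgeConjecture.Cruxes.HLiu418.K2LiuKindWArchCharacterFrameReading

open K2LiuSiegelUnipotentLocalDefs
open K2LiuSiegelUnipotentFourierDefs (unipDeltaChar)
open K2LiuSiegelUnipotentCharacterFactorisation (unipDeltaChar_archToAdelic_archPart map_trace_mul_toBlocks₁₂)
open K2LiuSiegelUnipotentArchPlaces (mem_unipDeltaArch_iff_forall_archAt)
open K2LiuArchSiegelCharacterTube (isComplex_infinitePlace)
open K2LiuArchUnipotentFrameCoordinates (eq_conj_of_frame_conj_eq)

/-! ## §1 Tate's character on an infinite adele of a totally complex field -/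

section Tate

variable (L : Type) [Field L] [NumberField L]

/-- **`conj ψ_L((y, 0)) = exp(2πi · Tr_{L_∞∕ℝ}(y))`**: Tate's global character on an adele with vanishing finite part is `exp(−2πi·Tr_{L_∞∕ℝ}(y))` (★
`adeleAddChar_apply_of_isFiniteIntegral`, `AddCircle.toCircle_apply_mk`, `Circle.coe_exp`), and complex conjugation flips the sign. [cite: CasselsFrohlichANT1967, Ch. XV (Tate) §4.1] -/
theorem conj_coe_adeleAddChar_infiniteAdeleInl (y : InfiniteAdeleRing L) :
    conj ((adeleAddChar L (infiniteAdeleInl L y) : Circle) : ℂ) = cexp (2 * Real.pi * I * ((infiniteAdeleTrace L y : ℝ) : ℂ)) := by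
  have hfi : IsFiniteIntegral L (infiniteAdeleInl L y) := fun v => isFiniteIntegral_zero L v
  rw [adeleAddChar_apply_of_isFiniteIntegral L hfi]
  change conj (((AddCircle.toCircle (-((infiniteAdeleTrace L y : ℝ) : AddCircle (1 : ℝ)))) : Circle) : ℂ) = _
  rw [← AddCircle.coe_neg, AddCircle.toCircle_apply_mk, Circle.coe_exp, div_one, ← Complex.exp_conj, map_mul, Complex.conj_ofReal, Complex.conj_I]
  congr 1
  push_cast
  ring

variable [IsCMField L]

/-- **`Tr_{L_∞∕ℝ}(y) = Σ_{w} 2 · Re σ_w(y_w)` over the complex places** of the totally complex field `L` (every infinite place of a CM field is complex, ★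
`isComplex_infinitePlace`; `mult w = 2`). [cite: CasselsFrohlichANT1967, Ch. XV (Tate) §2.2] -/
theorem infiniteAdeleTrace_eq_sum_isComplex (y : InfiniteAdeleRing L) :
    infiniteAdeleTrace L y = ∑ w : {w : InfinitePlace L // w.IsComplex}, 2 * (Completion.extensionEmbedding w.1 (y w.1)).re := by
  rw [infiniteAdeleTrace_apply, ← (Equiv.subtypeUnivEquiv (isComplex_infinitePlace L)).sum_comp]
  refine Fintype.sum_congr _ _ fun w => ?_
  rw [Equiv.subtypeUnivEquiv_apply, mult_isComplex w]
  push_cast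
  ring

end Tate

/-! ## §2 The `w`-component of the adele `tr(S_𝔸 · X(ι_∞ a))` -/

section Place

variable (L : Type) [Field L] [NumberField L] [IsCMField L] {N M n : ℕ} (e : Fin N × Fin M ≃ Fin n)
  (dV : Fin N → L) (hdV : ∀ i, IsCMField.complexConj L (dV i) = dV i)
  (dW : Fin M → L) (hdW : ∀ i, IsCMField.complexConj L (dW i) = dW i)

omit [IsCMField L] in
/-- the place evaluation `𝔸_L → L_∞ → L_w → ℂ` on a principal adele is the embedding `σ_w` (★ `Completion.extensionEmbedding_coe`). [folklore] -/
theorem placeEval_algebraMap (w : {w : InfinitePlace L // w.IsComplex}) (k : L) :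
    ((Completion.extensionEmbedding w.1).comp ((Pi.evalRingHom (fun v : InfinitePlace L => v.Completion) w.1).comp (adeleFst L)))
        (algebraMap L (AdeleRing (𝓞 L) L) k) = w.1.embedding k := by
  change Completion.extensionEmbedding w.1 (((WithAbs.equiv w.1.1).symm k : WithAbs w.1.1) : w.1.Completion) = _
  rw [Completion.extensionEmbedding_coe, RingEquiv.apply_symm_apply]

/-- **`σ_w(tr(S_𝔸 · X(u))_w) = tr(σ_w(S) · X(U_w))`** whenever the adelic matrix of `u` maps to `U_w` under the place evaluation `𝔸_L → L_∞ → L_w → ℂ` — used with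
`u = ι_∞ a`, `U_w = a_w = archAt a w` (★ `map_placeEval_coe_archToAdelic`); ★ `map_trace_mul_toBlocks₁₂` along the place evaluation, `placeEval_algebraMap`.
[cite: Shimura1997, §18.1 (18.4)] [cite: BorelJacquet1979, §4.1] -/
theorem extensionEmbedding_trace_of_map_eq (S : Matrix (Fin n) (Fin n) L) (u : HA L e dV hdV dW hdW) (w : {w : InfinitePlace L // w.IsComplex})
    (Uw : Matrix (Fin (n + n)) (Fin (n + n)) ℂ)
    (hu : (((u : HA L e dV hdV dW hdW) : GL (Fin (n + n)) (AdeleRing (𝓞 L) L)) : Matrix (Fin (n + n)) (Fin (n + n)) (AdeleRing (𝓞 L) L)).map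
      ((Completion.extensionEmbedding w.1).comp ((Pi.evalRingHom (fun v : InfinitePlace L => v.Completion) w.1).comp (adeleFst L))) = Uw) :
    Completion.extensionEmbedding w.1
        ((Matrix.trace (S.map (algebraMap L (AdeleRing (𝓞 L) L)) *
          (Matrix.reindex (e₂ (n := n)).symm (e₂ (n := n)).symm
            (((u : HA L e dV hdV dW hdW) : GL (Fin (n + n)) (AdeleRing (𝓞 L) L)) : Matrix (Fin (n + n)) (Fin (n + n)) (AdeleRing (𝓞 L) L))).toBlocks₁₂)).1 w.1) =
      Matrix.trace (S.map w.1.embedding * (Matrix.reindex (e₂ (n := n)).symm (e₂ (n := n)).symm Uw).toBlocks₁₂) := by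
  have h := map_trace_mul_toBlocks₁₂
    ((Completion.extensionEmbedding w.1).comp ((Pi.evalRingHom (fun v : InfinitePlace L => v.Completion) w.1).comp (adeleFst L)))
    (S.map (algebraMap L (AdeleRing (𝓞 L) L)))
    (((u : HA L e dV hdV dW hdW) : GL (Fin (n + n)) (AdeleRing (𝓞 L) L)) : Matrix (Fin (n + n)) (Fin (n + n)) (AdeleRing (𝓞 L) L))
  rw [hu, Matrix.map_map] at h
  have hS : (S.map (((Completion.extensionEmbedding w.1).comp ((Pi.evalRingHom (fun v : InfinitePlace L => v.Completion) w.1).comp (adeleFst L))) ∘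
      (algebraMap L (AdeleRing (𝓞 L) L)))) = S.map w.1.embedding := by
    ext i j
    simp only [Matrix.map_apply, Function.comp_apply]
    exact placeEval_algebraMap L w (S i j)
  rw [hS] at h
  exact h

end Place

/-! ## §3 Frame algebra: `X(a_w) = (T_w⁻¹)₁₁ · (Fr a w)₁₂ · (T_w)₂₂` on `N_Δ(L⁺ ⊗ ℝ)` -/

section Frame

/-- block algebra: `(Q · n(b) · P)₁₂ = Q₁₁ · b · P₂₂` whenever `Q · P = 1` (the `(1,2)`-block of `Q P` vanishes). [folklore] -/
theorem toBlocks₁₂_conj_transl {R : Type*} [CommRing R] {m : Type*} [Fintype m] [DecidableEq m]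
    (Q P : Matrix (m ⊕ m) (m ⊕ m) R) (hQP : Q * P = 1) (b : Matrix m m R) :
    (Q * fromBlocks 1 b 0 1 * P).toBlocks₁₂ = Q.toBlocks₁₁ * b * P.toBlocks₂₂ := by
  obtain ⟨q₁₁, q₁₂, q₂₁, q₂₂, rfl⟩ : ∃ q₁₁ q₁₂ q₂₁ q₂₂ : Matrix m m R, Q = fromBlocks q₁₁ q₁₂ q₂₁ q₂₂ := ⟨_, _, _, _, (Matrix.fromBlocks_toBlocks Q).symm⟩
  obtain ⟨p₁₁, p₁₂, p₂₁, p₂₂, rfl⟩ : ∃ p₁₁ p₁₂ p₂₁ p₂₂ : Matrix m m R, P = fromBlocks p₁₁ p₁₂ p₂₁ p₂₂ := ⟨_, _, _, _, (Matrix.fromBlocks_toBlocks P).symm⟩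
  have h12 := congr_arg Matrix.toBlocks₁₂ hQP
  rw [Matrix.fromBlocks_multiply, Matrix.toBlocks_fromBlocks₁₂, ← Matrix.fromBlocks_one, Matrix.toBlocks_fromBlocks₁₂] at h12
  simp only [Matrix.fromBlocks_multiply, Matrix.toBlocks_fromBlocks₁₂, Matrix.toBlocks_fromBlocks₁₁, Matrix.toBlocks_fromBlocks₂₂, Matrix.mul_one,
    Matrix.mul_zero, add_zero]
  rw [Matrix.add_mul, ← add_assoc, add_right_comm, h12, zero_add]

variable (L : Type) [Field L] [NumberField L] [IsCMField L] {N M n : ℕ} (e : Fin N × Fin M ≃ Fin n)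
  (dV : Fin N → L) (hdV : ∀ i, IsCMField.complexConj L (dV i) = dV i)
  (dW : Fin M → L) (hdW : ∀ i, IsCMField.complexConj L (dW i) = dW i)
  (T Tinv : {w : InfinitePlace L // w.IsComplex} → Matrix (Fin n ⊕ Fin n) (Fin n ⊕ Fin n) ℂ)
  (Fr : UnitaryGroup.arch (Fp L) L (IsCMField.complexConj L) (n + n) (hermD L e dV hdV dW hdW) →
    {w : InfinitePlace L // w.IsComplex} → Matrix (Fin n ⊕ Fin n) (Fin n ⊕ Fin n) ℂ)
  (hFr : ∀ a w, Fr a w = T w * Matrix.reindex (e₂ (n := n)).symm (e₂ (n := n)).symm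
    (((UnitaryGroup.archAt (Fp L) L (IsCMField.complexConj L) (n + n) (hermD L e dV hdV dW hdW) w
      (UnitaryGroup.complexConj_smul_infinitePlace L w.1) (IsCMField.complexConj_ne_one L) a :
        UnitaryGroup.archLocal L (n + n) (hermD L e dV hdV dW hdW) w) : GL (Fin (n + n)) ℂ) : Matrix (Fin (n + n)) (Fin (n + n)) ℂ) * Tinv w)
  (hT2 : ∀ w, Tinv w * T w = 1)
  (hTiv : ∀ w (u : GL (Fin (n + n)) ℂ), u ∈ UnitaryGroup.archLocal L (n + n) (hermD L e dV hdV dW hdW) w →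
    IsUnipM (n := n) (u : Matrix (Fin (n + n)) (Fin (n + n)) ℂ) →
      ∃ b : Matrix (Fin n) (Fin n) ℂ, bᴴ = b ∧ T w * Matrix.reindex (e₂ (n := n)).symm (e₂ (n := n)).symm (u : Matrix _ _ ℂ) * Tinv w = fromBlocks 1 b 0 1)

include hFr hTiv in
/-- **on `N_Δ(L⁺ ⊗ ℝ)` the frame is the hermitian translation by its own `(1,2)`-block**: `Fr a w = n(b_w)`, `b_w := (Fr a w)₁₂`, `b_wᴴ = b_w` (★ `mem_unipDeltaArch_iff_forall_archAt`,
★ `hTiv`). [cite: BorelJacquet1979, §4.1] [cite: Shimura1997, §18.1] -/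
theorem frame_eq_transl_toBlocks₁₂ (a : ↥(unipDeltaArch L e dV hdV dW hdW)) (w : {w : InfinitePlace L // w.IsComplex}) :
    Fr (a : UnitaryGroup.arch (Fp L) L (IsCMField.complexConj L) (n + n) (hermD L e dV hdV dW hdW)) w =
        fromBlocks 1 ((Fr (a : UnitaryGroup.arch (Fp L) L (IsCMField.complexConj L) (n + n) (hermD L e dV hdV dW hdW)) w).toBlocks₁₂) 0 1 ∧
      ((Fr (a : UnitaryGroup.arch (Fp L) L (IsCMField.complexConj L) (n + n) (hermD L e dV hdV dW hdW)) w).toBlocks₁₂)ᴴ =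
        (Fr (a : UnitaryGroup.arch (Fp L) L (IsCMField.complexConj L) (n + n) (hermD L e dV hdV dW hdW)) w).toBlocks₁₂ := by
  have hu := (mem_unipDeltaArch_iff_forall_archAt L e dV hdV dW hdW
    (a : UnitaryGroup.arch (Fp L) L (IsCMField.complexConj L) (n + n) (hermD L e dV hdV dW hdW))).1 a.2 w
  obtain ⟨b, hb, hFb⟩ := hTiv w _ (UnitaryGroup.archAt (Fp L) L (IsCMField.complexConj L) (n + n) (hermD L e dV hdV dW hdW) w
    (UnitaryGroup.complexConj_smul_infinitePlace L w.1) (IsCMField.complexConj_ne_one L)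
      (a : UnitaryGroup.arch (Fp L) L (IsCMField.complexConj L) (n + n) (hermD L e dV hdV dW hdW))).2 hu
  rw [← hFr] at hFb
  rw [hFb, Matrix.toBlocks_fromBlocks₁₂]
  exact ⟨rfl, hb⟩

include hFr hT2 hTiv in
/-- **`X(a_w) = (T_w⁻¹)₁₁ · (Fr a w)₁₂ · (T_w)₂₂`** for `a ∈ N_Δ(L⁺ ⊗ ℝ)`: the `(1,2)`-block of the place component in the standard `(n+n)`-splitting, through the frame
(`ã_w = T_w⁻¹ · Fr a w · T_w`, ★ `eq_conj_of_frame_conj_eq`; `Fr a w = n(b_w)`; block algebra `toBlocks₁₂_conj_transl` with `T_w⁻¹ T_w = 1`).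
[cite: Shimura1997, §18.1 (18.4)] [cite: BorelJacquet1979, §4.1] -/
theorem toBlocks₁₂_archAt_eq (a : ↥(unipDeltaArch L e dV hdV dW hdW)) (w : {w : InfinitePlace L // w.IsComplex}) :
    (Matrix.reindex (e₂ (n := n)).symm (e₂ (n := n)).symm
        (((UnitaryGroup.archAt (Fp L) L (IsCMField.complexConj L) (n + n) (hermD L e dV hdV dW hdW) w
            (UnitaryGroup.complexConj_smul_infinitePlace L w.1) (IsCMField.complexConj_ne_one L)
              (a : UnitaryGroup.arch (Fp L) L (IsCMField.complexConj L) (n + n) (hermD L e dV hdV dW hdW)) :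
                UnitaryGroup.archLocal L (n + n) (hermD L e dV hdV dW hdW) w) : GL (Fin (n + n)) ℂ) : Matrix (Fin (n + n)) (Fin (n + n)) ℂ)).toBlocks₁₂ =
      (Tinv w).toBlocks₁₁ * ((Fr (a : UnitaryGroup.arch (Fp L) L (IsCMField.complexConj L) (n + n) (hermD L e dV hdV dW hdW)) w).toBlocks₁₂) * (T w).toBlocks₂₂ := by
  have hn := (frame_eq_transl_toBlocks₁₂ L e dV hdV dW hdW T Tinv Fr hFr hTiv a w).1
  rw [hFr] at hn
  have hX := eq_conj_of_frame_conj_eq L T Tinv hT2 w hn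
  rw [hX, ← hFr]
  exact toBlocks₁₂_conj_transl (Tinv w) (T w) (hT2 w) _

end Frame

/-! ## §4 The frame reading with the real part (unconditional) -/

section Reading

variable (L : Type) [Field L] [NumberField L] [IsCMField L] {N M n : ℕ} (e : Fin N × Fin M ≃ Fin n)
  (dV : Fin N → L) (hdV : ∀ i, IsCMField.complexConj L (dV i) = dV i)
  (dW : Fin M → L) (hdW : ∀ i, IsCMField.complexConj L (dW i) = dW i)
  (T Tinv : {w : InfinitePlace L // w.IsComplex} → Matrix (Fin n ⊕ Fin n) (Fin n ⊕ Fin n) ℂ)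
  (Fr : UnitaryGroup.arch (Fp L) L (IsCMField.complexConj L) (n + n) (hermD L e dV hdV dW hdW) →
    {w : InfinitePlace L // w.IsComplex} → Matrix (Fin n ⊕ Fin n) (Fin n ⊕ Fin n) ℂ)
  (hFr : ∀ a w, Fr a w = T w * Matrix.reindex (e₂ (n := n)).symm (e₂ (n := n)).symm
    (((UnitaryGroup.archAt (Fp L) L (IsCMField.complexConj L) (n + n) (hermD L e dV hdV dW hdW) w
      (UnitaryGroup.complexConj_smul_infinitePlace L w.1) (IsCMField.complexConj_ne_one L) a :
        UnitaryGroup.archLocal L (n + n) (hermD L e dV hdV dW hdW) w) : GL (Fin (n + n)) ℂ) : Matrix (Fin (n + n)) (Fin (n + n)) ℂ) * Tinv w)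
  (hT2 : ∀ w, Tinv w * T w = 1)
  (hTiv : ∀ w (u : GL (Fin (n + n)) ℂ), u ∈ UnitaryGroup.archLocal L (n + n) (hermD L e dV hdV dW hdW) w →
    IsUnipM (n := n) (u : Matrix (Fin (n + n)) (Fin (n + n)) ℂ) →
      ∃ b : Matrix (Fin n) (Fin n) ℂ, bᴴ = b ∧ T w * Matrix.reindex (e₂ (n := n)).symm (e₂ (n := n)).symm (u : Matrix _ _ ℂ) * Tinv w = fromBlocks 1 b 0 1)

/-- trace bookkeeping: `tr((−2 · T₂₂ σS Ti₁₁) · b) = −2 · tr(σS · (Ti₁₁ · b · T₂₂))` (cyclicity). [folklore] -/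
theorem trace_framedIndex_mul {m : Type*} [Fintype m] (T₂₂ σS Ti₁₁ b : Matrix m m ℂ) :
    (((-2 : ℂ) • (T₂₂ * σS * Ti₁₁)) * b).trace = -2 * (σS * (Ti₁₁ * b * T₂₂)).trace := by
  rw [Matrix.smul_mul, Matrix.trace_smul, smul_eq_mul]
  congr 1
  rw [show T₂₂ * σS * Ti₁₁ * b = T₂₂ * (σS * (Ti₁₁ * b)) by simp only [Matrix.mul_assoc], Matrix.trace_mul_comm]
  simp only [Matrix.mul_assoc]

include hFr hT2 hTiv in
/-- **THE CHARACTER'S FRAME READING, REAL-PART FORM (unconditional).**  For every `S ∈ M_n(L)` and `a ∈ N_Δ(L⁺ ⊗ ℝ)`: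
`conj ψ_S(ι_∞ a) = ∏_{w} exp(−2πi · Re tr(h_w · b_w))`, `b_w = (Fr a w)₁₂`, **`h_w = −2 · (T_w)₂₂ · σ_w(S) · (T_w⁻¹)₁₁`** — from ★ Φ1 `unipDeltaChar` = Tate's `ψ_L(tr(S_𝔸 X(·)))`, ★ Φ3d (d1)
`unipDeltaChar_archToAdelic_archPart`, §1 (`conj ψ_L((y,0)) = e^{2πi Tr_∞ y}`, `Tr_∞ = Σ_w 2 Re σ_w`), §2 (`σ_w(x_w) = tr(σ_w(S) X(a_w))`), §3 (`X(a_w) = (T⁻¹)₁₁ b_w T₂₂`).  Frame letters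
`(T, Tinv, Fr, hFr, hT2, hTiv)` BY VALUE (★ FILE 12's block). [cite: CasselsFrohlichANT1967, Ch. XV (Tate) Lemma 3.2.1, §4.1] [cite: Shimura1997, §18.1 (18.4)] [cite: MoeglinWaldspurger1995, II.1.5] -/
theorem conj_unipDeltaChar_archToAdelic_eq_prod_re (S : Matrix (Fin n) (Fin n) L) (a : ↥(unipDeltaArch L e dV hdV dW hdW)) :
    conj (unipDeltaChar L e dV hdV dW hdW S
        (UnitaryGroup.archToAdelic (Fp L) L (IsCMField.complexConj L) (n + n) (hermD L e dV hdV dW hdW)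
          (a : UnitaryGroup.arch (Fp L) L (IsCMField.complexConj L) (n + n) (hermD L e dV hdV dW hdW))) : ℂ) =
      ∏ w : {w : InfinitePlace L // w.IsComplex},
        cexp (-(2 * Real.pi * I) * ((((((-2 : ℂ) • ((T w).toBlocks₂₂ * S.map w.1.embedding * (Tinv w).toBlocks₁₁)) *
          (Fr (a : UnitaryGroup.arch (Fp L) L (IsCMField.complexConj L) (n + n) (hermD L e dV hdV dW hdW)) w).toBlocks₁₂).trace).re : ℝ) : ℂ)) := by
  -- ★ Φ3d (d1): `ψ_S(ι_∞ a) = ψ_L((x_∞, 0))`, `x = tr(S_𝔸 X(ι_∞ a))`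
  have hψ := unipDeltaChar_archToAdelic_archPart L e dV hdV dW hdW S
    (UnitaryGroup.archToAdelic (Fp L) L (IsCMField.complexConj L) (n + n) (hermD L e dV hdV dW hdW)
      (a : UnitaryGroup.arch (Fp L) L (IsCMField.complexConj L) (n + n) (hermD L e dV hdV dW hdW)))
  rw [archPart_archToAdelic] at hψ
  rw [hψ, conj_coe_adeleAddChar_infiniteAdeleInl, infiniteAdeleTrace_eq_sum_isComplex, Complex.ofReal_sum, Finset.mul_sum, Complex.exp_sum]
  refine Finset.prod_congr rfl fun w _ => ?_
  congr 1
  -- per place: `σ_w(x_w) = tr(σ_w(S) X(a_w))`, `X(a_w) = Ti₁₁ b T₂₂`, and the trace bookkeeping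
  rw [extensionEmbedding_trace_of_map_eq L e dV hdV dW hdW S _ w _
      (map_placeEval_coe_archToAdelic (Fp L) L (IsCMField.complexConj L) (n + n) (hermD L e dV hdV dW hdW) w
        (UnitaryGroup.complexConj_smul_infinitePlace L w.1) (IsCMField.complexConj_ne_one L) _),
    toBlocks₁₂_archAt_eq L e dV hdV dW hdW T Tinv Fr hFr hT2 hTiv a w, trace_framedIndex_mul,
    show ((-2 : ℂ) * (S.map w.1.embedding * ((Tinv w).toBlocks₁₁ *
        (Fr (a : UnitaryGroup.arch (Fp L) L (IsCMField.complexConj L) (n + n) (hermD L e dV hdV dW hdW)) w).toBlocks₁₂ * (T w).toBlocks₂₂)).trace).re =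
      -2 * (S.map w.1.embedding * ((Tinv w).toBlocks₁₁ *
        (Fr (a : UnitaryGroup.arch (Fp L) L (IsCMField.complexConj L) (n + n) (hermD L e dV hdV dW hdW)) w).toBlocks₁₂ * (T w).toBlocks₂₂)).trace.re by
      simp [Complex.mul_re]]
  push_cast
  ring

end Reading

/-! ## §5 Hermitian framed indices: the reading in the shape of the per-place letters -/

section Hermitian

/-- for hermitian `h`, `b` the trace `tr(h · b)` is real. [folklore] -/
theorem trace_mul_ofReal_re_of_conjTranspose {m : Type*} [Fintype m] {h b : Matrix m m ℂ} (hh : hᴴ = h) (hb : bᴴ = b) :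
    ((((h * b).trace).re : ℝ) : ℂ) = (h * b).trace := by
  refine Complex.conj_eq_iff_re.1 ?_
  have h1 : conj ((h * b).trace) = ((h * b)ᴴ).trace := by rw [Matrix.trace_conjTranspose]; rfl
  rw [h1, Matrix.conjTranspose_mul, hh, hb, Matrix.trace_mul_comm]

variable (L : Type) [Field L] [NumberField L] [IsCMField L] {N M n : ℕ} (e : Fin N × Fin M ≃ Fin n)
  (dV : Fin N → L) (hdV : ∀ i, IsCMField.complexConj L (dV i) = dV i)
  (dW : Fin M → L) (hdW : ∀ i, IsCMField.complexConj L (dW i) = dW i)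
  (T Tinv : {w : InfinitePlace L // w.IsComplex} → Matrix (Fin n ⊕ Fin n) (Fin n ⊕ Fin n) ℂ)
  (Fr : UnitaryGroup.arch (Fp L) L (IsCMField.complexConj L) (n + n) (hermD L e dV hdV dW hdW) →
    {w : InfinitePlace L // w.IsComplex} → Matrix (Fin n ⊕ Fin n) (Fin n ⊕ Fin n) ℂ)
  (hFr : ∀ a w, Fr a w = T w * Matrix.reindex (e₂ (n := n)).symm (e₂ (n := n)).symm
    (((UnitaryGroup.archAt (Fp L) L (IsCMField.complexConj L) (n + n) (hermD L e dV hdV dW hdW) w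
      (UnitaryGroup.complexConj_smul_infinitePlace L w.1) (IsCMField.complexConj_ne_one L) a :
        UnitaryGroup.archLocal L (n + n) (hermD L e dV hdV dW hdW) w) : GL (Fin (n + n)) ℂ) : Matrix (Fin (n + n)) (Fin (n + n)) ℂ) * Tinv w)
  (hT2 : ∀ w, Tinv w * T w = 1)
  (hTiv : ∀ w (u : GL (Fin (n + n)) ℂ), u ∈ UnitaryGroup.archLocal L (n + n) (hermD L e dV hdV dW hdW) w →
    IsUnipM (n := n) (u : Matrix (Fin (n + n)) (Fin (n + n)) ℂ) →
      ∃ b : Matrix (Fin n) (Fin n) ℂ, bᴴ = b ∧ T w * Matrix.reindex (e₂ (n := n)).symm (e₂ (n := n)).symm (u : Matrix _ _ ℂ) * Tinv w = fromBlocks 1 b 0 1)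

include hFr hT2 hTiv in
/-- **THE LETTER `heb`, IN THE SHAPE OF THE PER-PLACE WHITTAKER LETTERS.**  Frame letters `(T, Tinv, Fr, hFr, hT2, hTiv)` BY VALUE; the framed indices `hidx w` BY VALUE with
their reading `hhidx : hidx w = −2 · (T_w)₂₂ · σ_w(S) · (T_w⁻¹)₁₁` and hermitian-ness `hherm` (the per-place payers' signature bookkeeping in the closed-form Shimura frame;
true for `S` skew w.r.t. `gramR`).  THEN for every `a ∈ N_Δ(L⁺ ⊗ ℝ)`:
`conj (unipDeltaChar S (archToAdelic ↑a)) = ∏ w, cexp (−(2πI) · tr(hidx w · (Fr ↑a w)₁₂))` — i.e. ★ `hex_of_sumPresentation`'s `heb` with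
`eb w b := cexp (-(2 * Real.pi * I) * (hidx w * b).trace)` (= ★ `K2LiuKindWArchWhittakerLetter`'s reading `heb`, `rfl`). (§4 + `trace_mul_ofReal_re_of_conjTranspose`, `b_w`
hermitian by §3.) [cite: CasselsFrohlichANT1967, Ch. XV (Tate) Lemma 3.2.1, §4.1] [cite: Shimura1997, §18.1 (18.4), §A3] [cite: MoeglinWaldspurger1995, II.1.5] -/
theorem conj_unipDeltaChar_archToAdelic_eq_prod (S : Matrix (Fin n) (Fin n) L)
    (hidx : {w : InfinitePlace L // w.IsComplex} → Matrix (Fin n) (Fin n) ℂ)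
    (hhidx : ∀ w, hidx w = (-2 : ℂ) • ((T w).toBlocks₂₂ * S.map w.1.embedding * (Tinv w).toBlocks₁₁))
    (hherm : ∀ w, (hidx w)ᴴ = hidx w) (a : ↥(unipDeltaArch L e dV hdV dW hdW)) :
    conj (unipDeltaChar L e dV hdV dW hdW S
        (UnitaryGroup.archToAdelic (Fp L) L (IsCMField.complexConj L) (n + n) (hermD L e dV hdV dW hdW)
          (a : UnitaryGroup.arch (Fp L) L (IsCMField.complexConj L) (n + n) (hermD L e dV hdV dW hdW))) : ℂ) =
      ∏ w : {w : InfinitePlace L // w.IsComplex},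
        cexp (-(2 * Real.pi * I) * (hidx w * (Fr (a : UnitaryGroup.arch (Fp L) L (IsCMField.complexConj L) (n + n) (hermD L e dV hdV dW hdW)) w).toBlocks₁₂).trace) := by
  rw [conj_unipDeltaChar_archToAdelic_eq_prod_re L e dV hdV dW hdW T Tinv Fr hFr hT2 hTiv S a]
  refine Finset.prod_congr rfl fun w _ => ?_
  rw [← hhidx w, trace_mul_ofReal_re_of_conjTranspose (hherm w) (frame_eq_transl_toBlocks₁₂ L e dV hdV dW hdW T Tinv Fr hFr hTiv a w).2]

include hFr hT2 hTiv in
/-- **`heb` AS THE LETTER** (the ∃-free reading packaged for ★ `hex_of_sumPresentation` ∕ ★ `K2LiuKindWArchContinuationOfRecord`'s `∀ eb, heb → …` heads): with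
`eb w b := cexp (-(2 * Real.pi * I) * (hidx w * b).trace)`, `∀ a, conj (unipDeltaChar S (archToAdelic ↑a)) = ∏ w, eb w (toBlocks₁₂ (Fr ↑a w))`.
[cite: Shimura1997, §18.1 (18.4)] [cite: MoeglinWaldspurger1995, II.1.5] -/
theorem heb_of_hermitian_framedIndex (S : Matrix (Fin n) (Fin n) L)
    (hidx : {w : InfinitePlace L // w.IsComplex} → Matrix (Fin n) (Fin n) ℂ)
    (hhidx : ∀ w, hidx w = (-2 : ℂ) • ((T w).toBlocks₂₂ * S.map w.1.embedding * (Tinv w).toBlocks₁₁))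
    (hherm : ∀ w, (hidx w)ᴴ = hidx w) :
    ∀ a : ↥(unipDeltaArch L e dV hdV dW hdW),
      conj (unipDeltaChar L e dV hdV dW hdW S
          (UnitaryGroup.archToAdelic (Fp L) L (IsCMField.complexConj L) (n + n) (hermD L e dV hdV dW hdW)
            (a : UnitaryGroup.arch (Fp L) L (IsCMField.complexConj L) (n + n) (hermD L e dV hdV dW hdW))) : ℂ) =
        ∏ w : {w : InfinitePlace L // w.IsComplex},
          (fun (w : {w : InfinitePlace L // w.IsComplex}) (b : Matrix (Fin n) (Fin n) ℂ) => cexp (-(2 * Real.pi * I) * (hidx w * b).trace)) w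
            (Matrix.toBlocks₁₂ (Fr (a : UnitaryGroup.arch (Fp L) L (IsCMField.complexConj L) (n + n) (hermD L e dV hdV dW hdW)) w)) :=
  fun a => conj_unipDeltaChar_archToAdelic_eq_prod L e dV hdV dW hdW T Tinv Fr hFr hT2 hTiv S hidx hhidx hherm a

end Hermitian

end Summit.HodgeConjecture.HodgeConjecture.Cruxes.HLiu418.K2LiuKindWArchCharacterFrameReading

end
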